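import Summits.BirchSwinnertonDyer.Rank1Residual.GaloisImage.KatoKuriharaValueRowOfComparison
import Summits.BirchSwinnertonDyer.BirchSwinnertonDyer.Theorems.KimAtThreeShallowEqDeepAnomalousGlue
import HarnessLib

/-!
# Route `KimAtThreeKolyvagin` (W2): THE VALUE ROW at a tame level `(σ, r)` ON THE TWISTED LATTICE, from
# the FACTORED comparison (value side of the Kato–Kurihara port on the good ANOMALOUS rows at `3`, file 4)

Cell `bsd-addord`, seat `bsd-addord-w2-c4` (gen 9; owner of crux 19599 `ShallowEqDeepOffKatoStratum`, item
19077 `ShallowEqDeepAtTorsionFree`).  `--supports` 19599.  HONEST FRAMING: ONE TOOL THEOREM (no definition,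
no named fact, no instance, no `sorry`); pure composition of n1011's T-PK6-VROW with the seat's twisted glue;
nothing about any curve is asserted beyond the displayed hypotheses; nothing is booked; 19599 / 19077 / 19560
stay OPEN; BSD is not proved by any of this.  Credit: n1011-p02's ★★ `ValueRow.exists_valueRow_of_mem_map_span`
(T-PK6-VROW) — this file is that theorem VERBATIM up to the last two steps (the logarithms `ψ`, PK-3's generator
hypotheses, PK-3 `MazurTateDerivative.mapRingHom_padicLift_mul_prod_deriv_eq_kuriharaNumber_smul`, the norm
element — all BY NAME as there), with the comparison in the seat's FACTORED currency and the conclusion on the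
TWISTED lattice.

## What

★★ `exists_valueRow_twist_of_factor_mul`: data as in T-PK6-VROW ★★ (`p` odd, `f` the newform of `W`, `E[p]`
irreducible; THEOREM D's generators `σ_q ∈ I_q` with `χ_{N𝔮}(σ_q) = η_q`, `η` primitive on `r`, `r` Kolyvagin of
level `k + 1`; the value `xr` with avatar `X`; PK-3's integral structure `Θ₀`; an integral twist `V` with UNIT
augmentation) PLUS an integral factor `P` (intended: the `p`-Euler factor `p − a_pδ_{[p]⁻¹} + 𝟙δ_{[p]⁻²}`) and
the FACTORED comparison `∏D · (((p·n)•(1+δ₋₁)X)^{ℚ_p} − (Θ₀·(P·V))^{ℚ_p}) = (P·Y)^{ℚ_p}`, `Y ∈ p^{k+1}ℤ_p[(ℤ/n)ˣ]`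
(`hcmp`, the OUT of `KimAtThreeShallowEqDeepAnomalousCongruenceOfZetaBody`).  Conclusion — the value row ON THE
TWISTED LATTICE:
`∃ s u ψ, (∀ q ∈ r, ψ_{N𝔮} onto) ∧ [∃ l ∈ L_int, (p : ℤ_p) • (1 ⊗ 𝔇^{field}(xr + σ₋₁ xr)) − (s · aug P) ⊗ 1
   = p^{k+1} • Σ_g P_g • (1 ⊗ σ_g) l] ∧ s̄ = u · p⁰ · δ̃_{n(r)}(ψ)`.
WHY (anomalous rows, `a₃ ∈ {1, −2}`, `t = 0`): the dual-exponential lattice of the level field at `3` is the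
Euler-factor lattice `(1 ⊗ P)·L_int` (the seat's lattice lemma), so the (P-EXP) rider's scalar clause must be —
and for Kato's witnesses IS — stated on that lattice with the scalar `s · aug P = s · #Ẽ(𝔽_p)`, which the
functional `exp*_ω / E_p(1)` divides out: NO digit of `δ̃` is lost (contrast: reading the same congruence in
`p^{k+1}L_int` gives only `s̄ = u · p · δ̃`, w2-c3's `valueRow_of_zetaBody_pow` with `α = 1`).
HONEST LIMITS: `hcmp`, `hxX`, `hV` are HYPOTHESES; closes nothing; books nothing; 0 defs / 0 facts.

References: C.-H. Kim, AJM 148 (2026) = arXiv:2203.12159 v3, §3.4.1–§3.5 and the proof of Thm. 3.13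
[Kim2022StructureSelmer]; C.-H. Kim, K. Nakamura, JNT 210 (2020) Prop. 3.5, Rem. 3.6 [KimNakamura2020];
M. Kurihara, arXiv:1407.2465 §1.1 [Kurihara2014]; K. Rubin, *Euler Systems* (2000) §4.4 [Rubin2000].
-/

noncomputable section

-- the Theorems namespace of a single-conjunct summit repeats the summit name by design (D-0017)
set_option linter.dupNamespace false

open scoped BigOperators NumberField TensorProduct
open Finset IsDedekindDomain NumberField Field WeierstrassCurve Rat.HeightOneSpectrum
open Literature.NumberTheory.GaloisRepresentations Literature.NumberTheory.GaloisCohomology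
open Literature.NumberTheory.LFunctions (absNorm_asIdeal_eq_primesEquiv)
open Literature.NumberTheory.EllipticCurves Literature.NumberTheory.EllipticCurves.ModularForms
open Literature.NumberTheory.EllipticCurves.Kato2004.EulerSystemValues
open Summit.BirchSwinnertonDyer.Rank1Residual.GaloisImage
open Summit.BirchSwinnertonDyer.Rank1Residual.GaloisImage.ValueRow

namespace Summit.BirchSwinnertonDyer.BirchSwinnertonDyer.Theorems.KimAtThreeShallowEqDeepAnomalousValueRow

variable (p : ℕ) [Fact p.Prime]
variable {W : WeierstrassCurve ℚ} [W.IsElliptic] [W.IsGloballyMinimal]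
variable {N₀ : ℕ} [NeZero N₀] (f : CuspForm (CongruenceSubgroup.Gamma0 N₀) 2)

set_option backward.isDefEq.respectTransparency false in
/-- **★★ THE VALUE ROW AT `(σ, r)` ON THE TWISTED LATTICE, FROM THE FACTORED COMPARISON** (module
docstring).  n1011-p02's T-PK6-VROW ★★ with `hmem` replaced by the FACTORED comparison `hcmp` (factor `P`,
unit-augmentation twist `V`) and the conclusion's lattice clause on `(1 ⊗ P)·L_int` with scalar `s · aug P`;
`s̄ = u · p⁰ · δ̃` for a unit `u`.
[cite: Kim2022StructureSelmer, §3.4.1–§3.5 and the proof of Thm. 3.13 (arXiv v3 pp. 26–28; = Thm. 3.11 of AJM 148)]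
[cite: KimNakamura2020, Prop. 3.5 and Rem. 3.6 (arXiv v2 pp. 8–9)] -/
theorem exists_valueRow_twist_of_factor_mul (hp2 : p ≠ 2) (hf : IsNewformOf W f)
    (hirr : W.HasIrreducibleModPGaloisRep p) (k : ℕ)
    (σ : HeightOneSpectrum (𝓞 ℚ) → absoluteGaloisGroup ℚ)
    (η : (q : HeightOneSpectrum (𝓞 ℚ)) → (ZMod (Ideal.absNorm q.asIdeal))ˣ)
    (hσI : ∀ q, σ q ∈ (adicCompletionPrime ℚ q).inertia (absoluteGaloisGroup ℚ))
    (hσχ : ∀ q, modNCyclotomicCharacter ℚ (Ideal.absNorm q.asIdeal) (σ q) = η q)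
    (r : Finset (HeightOneSpectrum (𝓞 ℚ)))
    (hη : ∀ q ∈ r, Subgroup.zpowers (η q) = ⊤)
    (hKol : ∀ q ∈ r, Kato.IsKolyvaginPrime W p (k + 1) ((primesEquiv q : Nat.Primes) : ℕ))
    (xr : CyclotomicField (cycLevel p 0 r) ℚ) (X : MonoidAlgebra ℚ (ZMod (cycLevel p 0 r))ˣ)
    (hxX : xr = ∑ g : (ZMod (cycLevel p 0 r))ˣ, X.coeff g •
      sigma (cycLevel p 0 r) g (IsCyclotomicExtension.zeta (cycLevel p 0 r) ℚ
        (CyclotomicField (cycLevel p 0 r) ℚ)))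
    (Θ₀ : MonoidAlgebra ℤ_[p] (ZMod (cycLevel p 0 r))ˣ)
    (hΘ : ∀ a : (ZMod (cycLevel p 0 r))ˣ, ((Θ₀.coeff a : ℤ_[p]) : ℚ_[p]) =
      ((ratPlusSymbol f ((((a : ZMod (cycLevel p 0 r))).val : ℚ) / (cycLevel p 0 r)) : ℚ) : ℚ_[p]))
    -- the integral twist WITHOUT its `p`-Euler factor (unit augmentation) and the `p`-Euler factor `P`
    (V : MonoidAlgebra ℤ_[p] (ZMod (cycLevel p 0 r))ˣ)
    (hV : IsUnit (∑ g : (ZMod (cycLevel p 0 r))ˣ, V.coeff g))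
    (P : MonoidAlgebra ℤ_[p] (ZMod (cycLevel p 0 r))ˣ)
    -- THE FACTORED COMPARISON (the seat's `…AnomalousCongruenceOfZetaBody` OUT at this `r`)
    (hcmp : ∃ Y ∈ Ideal.span {((p : MonoidAlgebra ℤ_[p] (ZMod (cycLevel p 0 r))ˣ)) ^ (k + 1)},
      (∏ q ∈ r, ∑ j : Fin (((primesEquiv q : Nat.Primes) : ℕ) - 1),
          MonoidAlgebra.single (modNCyclotomicCharacter ℚ (cycLevel p 0 r) (σ q) ^ (j : ℕ))
            ((j : ℕ) : ℚ_[p])) *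
          (MonoidAlgebra.mapRingHom (ZMod (cycLevel p 0 r))ˣ (algebraMap ℚ ℚ_[p])
              (((p : ℚ) * (cycLevel p 0 r : ℕ)) •
                ((1 + MonoidAlgebra.single (-1 : (ZMod (cycLevel p 0 r))ˣ) (1 : ℚ)) * X)) -
            MonoidAlgebra.mapRingHom (ZMod (cycLevel p 0 r))ˣ (PadicInt.Coe.ringHom (p := p))
              (Θ₀ * (P * V))) =
        MonoidAlgebra.mapRingHom (ZMod (cycLevel p 0 r))ˣ (PadicInt.Coe.ringHom (p := p)) (P * Y)) :
    ∃ (s : ℤ_[p]) (u : (ZMod (p ^ (k + 1)))ˣ)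
      (ψ : (ℓ : ℕ) → (ZMod ℓ)ˣ →* Multiplicative (ZMod (p ^ (k + 1)))),
      (∀ q ∈ r, Function.Surjective (ψ (Ideal.absNorm q.asIdeal))) ∧
      (∃ l ∈ cycIntLattice p (cycLevel p 0 r),
        (p : ℤ_[p]) • ((1 : ℚ_[p]) ⊗ₜ[ℚ]
          ((r.noncommProd (fun ℓ : HeightOneSpectrum (𝓞 ℚ) =>
              ∑ j ∈ Finset.range (((primesEquiv ℓ : Nat.Primes) : ℕ) - 1),
                (j : Module.End ℚ (CyclotomicField (cycLevel p 0 r) ℚ)) *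
                  (sigma (cycLevel p 0 r) (modNCyclotomicCharacter ℚ (cycLevel p 0 r) (σ ℓ)) :
                    CyclotomicField (cycLevel p 0 r) ℚ →ₐ[ℚ]
                      CyclotomicField (cycLevel p 0 r) ℚ).toLinearMap ^ j)
            (ZetaValue.pairwise_commute_fieldDeriv (cycLevel p 0 r)
              (fun ℓ => modNCyclotomicCharacter ℚ (cycLevel p 0 r) (σ ℓ))
              (fun ℓ => ((primesEquiv ℓ : Nat.Primes) : ℕ) - 1) r))
            (xr + sigma (cycLevel p 0 r) (-1) xr))) -
          (((s * ∑ g : (ZMod (cycLevel p 0 r))ˣ, P.coeff g : ℤ_[p]) : ℚ_[p]) ⊗ₜ[ℚ]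
            (1 : CyclotomicField (cycLevel p 0 r) ℚ)) =
        ((p : ℤ_[p]) ^ (k + 1)) • ∑ g : (ZMod (cycLevel p 0 r))ˣ, ((P.coeff g : ℤ_[p]) : ℚ_[p]) •
          Algebra.TensorProduct.map (AlgHom.id ℚ ℚ_[p])
            (sigma (cycLevel p 0 r) g : CyclotomicField (cycLevel p 0 r) ℚ →ₐ[ℚ]
              CyclotomicField (cycLevel p 0 r) ℚ) l) ∧
      haveI : NeZero (∏ q ∈ r, Ideal.absNorm q.asIdeal) :=
        ⟨Finset.prod_ne_zero_iff.2 fun q _ h => q.ne_bot (Ideal.absNorm_eq_zero_iff.1 h)⟩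
      PadicInt.toZModPow (k + 1) s = (u : ZMod (p ^ (k + 1))) *
        ((p : ℕ) : ZMod (p ^ (k + 1))) ^ (0 : ℕ) *
          kuriharaNumber f (p ^ (k + 1)) (∏ q ∈ r, Ideal.absNorm q.asIdeal) ψ := by
  classical
  haveI : NeZero (p ^ (k + 1)) := ⟨pow_ne_zero _ (Fact.out : p.Prime).ne_zero⟩
  -- ### the level `n = n(r)`: square-free Kolyvagin product, prime to `p`, reindexed by the places
  have hsf : Squarefree (cycLevel p 0 r) := TameLevel.squarefree_cycLevel_zero p r
  have hrp : ∀ q ∈ r, ((primesEquiv q : Nat.Primes) : ℕ) ≠ p := fun q hq => (hKol q hq).ne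
  have hKP : Kato.IsKolyvaginProduct W p (k + 1) (cycLevel p 0 r) := by
    refine ⟨hsf, fun ℓ hℓ => ?_⟩
    rw [TameLevel.primeFactors_cycLevel_zero, Finset.mem_image] at hℓ
    obtain ⟨q, hq, rfl⟩ := hℓ
    exact hKol q hq
  obtain ⟨e, he⟩ := TameLevel.exists_equiv_primeFactors_cycLevel_zero p r
  have hne : ∀ q : r, NeZero (((e q : (cycLevel p 0 r).primeFactors) : ℕ)) := fun q =>
    ⟨(Nat.prime_of_mem_primeFactors (e q).2).ne_zero⟩
  -- `(e q : ℕ) = ℓ_q = N𝔮`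
  have heN : ∀ q : r, (((e q : (cycLevel p 0 r).primeFactors) : ℕ)) =
      Ideal.absNorm (q : HeightOneSpectrum (𝓞 ℚ)).asIdeal := fun q => by
    rw [he q, absNorm_asIdeal_eq_primesEquiv]
  -- ### the logarithms `ψ`, normalised at THEOREM D's `η`
  have hm : ∀ q ∈ r, p ^ (k + 1) ∣ Ideal.absNorm q.asIdeal - 1 := fun q hq => by
    rw [absNorm_asIdeal_eq_primesEquiv]
    exact (Nat.modEq_iff_dvd' (hKol q hq).prime.one_lt.le).1 (hKol q hq).modEq_one.symm
  obtain ⟨ψ, hψ⟩ := exists_family_surjective_normalised (p ^ (k + 1)) r η hη hm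
  -- ### PK-3's generator hypotheses for `b_q = χ_n(σ_q)` (T-PK6-VAL FILE 3 ★)
  have hoff : ∀ q q' : r, q ≠ q' →
      ZMod.unitsMap (Nat.dvd_of_mem_primeFactors (e q').2)
        (modNCyclotomicCharacter ℚ (cycLevel p 0 r) (σ q)) = 1 := fun q q' hqq' =>
    unitsMap_modNCyclotomicCharacter_eq_one_of_mem_inertia p σ hσI r q (e q').2 fun h =>
      hqq' (Subtype.ext (primesEquiv.injective (Subtype.ext ((he q').symm.trans h).symm)))
  have hcyc : ∀ q : r, ∀ y : (ZMod (((e q : (cycLevel p 0 r).primeFactors) : ℕ)))ˣ,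
      y ∈ Subgroup.zpowers (ZMod.unitsMap (Nat.dvd_of_mem_primeFactors (e q).2)
        (modNCyclotomicCharacter ℚ (cycLevel p 0 r) (σ q))) := by
    intro q y
    haveI := hne q
    rw [unitsMap_modNCyclotomicCharacter_of_dvd ℚ (Nat.dvd_of_mem_primeFactors (e q).2) (σ q),
      ← unitsMap_modNCyclotomicCharacter_of_dvd ℚ (dvd_of_eq (heN q)) (σ q), hσχ]
    exact forall_mem_zpowers_unitsMap_of_eq (heN q) (η q) (hη q q.2) y
  have hψe : ∀ q : r, Multiplicative.toAdd
      (ψ (((e q : (cycLevel p 0 r).primeFactors) : ℕ))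
        (ZMod.unitsMap (Nat.dvd_of_mem_primeFactors (e q).2)
          (modNCyclotomicCharacter ℚ (cycLevel p 0 r) (σ q)))) = 1 := by
    intro q
    haveI := hne q
    rw [unitsMap_modNCyclotomicCharacter_of_dvd ℚ (Nat.dvd_of_mem_primeFactors (e q).2) (σ q),
      ← unitsMap_modNCyclotomicCharacter_of_dvd ℚ (dvd_of_eq (heN q)) (σ q), hσχ]
    exact (hψ _ q q.2 (heN q)).2
  obtain ⟨hσψ', hord', hgen'⟩ := UnitsCRT.generator_hypotheses_of_equiv (cycLevel p 0 r) r e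
    (fun q => modNCyclotomicCharacter ℚ (cycLevel p 0 r) (σ q)) hsf hoff hcyc ψ hψe
  -- ### PK-3 (Kim–Nakamura Prop. 3.5) at the level `n(r)`, reindexed by the places
  have hPK3 := MazurTateDerivative.mapRingHom_padicLift_mul_prod_deriv_eq_kuriharaNumber_smul f (k + 1)
    hf hp2 hirr hKP ψ hΘ (fun ℓ => modNCyclotomicCharacter ℚ (cycLevel p 0 r) (σ (e.symm ℓ)))
    hσψ' hord' hgen'
  have hb : ∀ q : r, modNCyclotomicCharacter ℚ (cycLevel p 0 r) (σ q) =
      (fun ℓ : (cycLevel p 0 r).primeFactors =>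
        modNCyclotomicCharacter ℚ (cycLevel p 0 r) (σ (e.symm ℓ))) (e q) := fun q => by
    simp only [Equiv.symm_apply_apply]
  have hN : ∀ q : r, ((primesEquiv (q : HeightOneSpectrum (𝓞 ℚ)) : Nat.Primes) : ℕ) - 1 =
      (fun ℓ : (cycLevel p 0 r).primeFactors => (ℓ : ℕ) - 1) (e q) := fun q => by
    simp only [he q]
  rw [GroupRingEval.prod_sum_fin_single_pow_eq_of_equiv r e
      (fun ℓ : (cycLevel p 0 r).primeFactors =>
        modNCyclotomicCharacter ℚ (cycLevel p 0 r) (σ (e.symm ℓ))) (fun ℓ => (ℓ : ℕ) - 1)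
      (fun q => modNCyclotomicCharacter ℚ (cycLevel p 0 r) (σ q))
      (fun q => ((primesEquiv q : Nat.Primes) : ℕ) - 1) (fun j => ((j : ℕ) : ZMod (p ^ (k + 1)))) hb hN,
    GroupRingEval.prod_sum_fin_single_pow_eq_of_equiv r e
      (fun ℓ : (cycLevel p 0 r).primeFactors =>
        modNCyclotomicCharacter ℚ (cycLevel p 0 r) (σ (e.symm ℓ))) (fun ℓ => (ℓ : ℕ) - 1)
      (fun q => modNCyclotomicCharacter ℚ (cycLevel p 0 r) (σ q))
      (fun q => ((primesEquiv q : Nat.Primes) : ℕ) - 1) (fun _ => (1 : ZMod (p ^ (k + 1)))) hb hN] at hPK3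
  -- `∏ Nrm = Σ_g δ_g` (T-PKEV E-A), reindexed
  have hnorm : ∏ q ∈ r, ∑ j : Fin (((primesEquiv q : Nat.Primes) : ℕ) - 1),
      MonoidAlgebra.single (modNCyclotomicCharacter ℚ (cycLevel p 0 r) (σ q) ^ (j : ℕ)) (1 : ℤ_[p]) =
        ∑ g : (ZMod (cycLevel p 0 r))ˣ, MonoidAlgebra.single g 1 := by
    rw [← GroupRingEval.prod_sum_fin_single_pow_eq_of_equiv r e
      (fun ℓ : (cycLevel p 0 r).primeFactors =>
        modNCyclotomicCharacter ℚ (cycLevel p 0 r) (σ (e.symm ℓ))) (fun ℓ => (ℓ : ℕ) - 1)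
      (fun q => modNCyclotomicCharacter ℚ (cycLevel p 0 r) (σ q))
      (fun q => ((primesEquiv q : Nat.Primes) : ℕ) - 1) (fun _ => (1 : ℤ_[p])) hb hN]
    exact GroupRingEval.prod_norm_eq_sum_single _ _ hgen'
      (GroupRingEval.card_units_zmod_eq_prod_sub_one (cycLevel p 0 r) hsf)
  -- ### the augmentation of `V̄` is a unit; the scalar `λ = n(r)` is a `p`-adic unit (T-PK6-VAL FILE 2)
  have hV' : IsUnit (PadicInt.toZModPow (k + 1) (∑ g : (ZMod (cycLevel p 0 r))ˣ, V.coeff g)) := hV.map _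
  obtain ⟨u, hu⟩ := TameLevel.exists_units_coe_eq_cycLevel_zero p r hrp
  rw [← Rat.cast_natCast] at hu
  -- ### the FACTORED comparison ⟹ the twisted `hXY`
  obtain ⟨Y, hYmem, hY⟩ := hcmp
  obtain ⟨Wc, hWc⟩ := Ideal.mem_span_singleton'.1 hYmem
  have hDint : MonoidAlgebra.mapRingHom (ZMod (cycLevel p 0 r))ˣ (PadicInt.Coe.ringHom (p := p))
      (∏ q ∈ r, ∑ j : Fin (((primesEquiv q : Nat.Primes) : ℕ) - 1),
        MonoidAlgebra.single (modNCyclotomicCharacter ℚ (cycLevel p 0 r) (σ q) ^ (j : ℕ)) ((j : ℕ) : ℤ_[p])) =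
      ∏ q ∈ r, ∑ j : Fin (((primesEquiv q : Nat.Primes) : ℕ) - 1),
        MonoidAlgebra.single (modNCyclotomicCharacter ℚ (cycLevel p 0 r) (σ q) ^ (j : ℕ)) ((j : ℕ) : ℚ_[p]) := by
    rw [GroupRingEval.mapRingHom_prod_sum_single_pow]
    simp_rw [map_natCast]
  have hpW : MonoidAlgebra.mapRingHom (ZMod (cycLevel p 0 r))ˣ (PadicInt.Coe.ringHom (p := p)) (P * Y) =
      ((p : ℚ_[p]) ^ (k + 1)) •
        MonoidAlgebra.mapRingHom (ZMod (cycLevel p 0 r))ˣ (PadicInt.Coe.ringHom (p := p)) (P * Wc) := by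
    rw [← hWc, ← mul_assoc, map_mul, map_pow, map_natCast, Algebra.smul_def, map_pow, map_natCast, mul_comm]
  have hXY : MonoidAlgebra.mapRingHom (ZMod (cycLevel p 0 r))ˣ (algebraMap ℚ ℚ_[p])
        (((p : ℚ) * (cycLevel p 0 r : ℕ)) •
          ((1 + MonoidAlgebra.single (-1 : (ZMod (cycLevel p 0 r))ˣ) (1 : ℚ)) * X)) *
      ∏ q ∈ r, ∑ j : Fin (((primesEquiv q : Nat.Primes) : ℕ) - 1),
        MonoidAlgebra.single (modNCyclotomicCharacter ℚ (cycLevel p 0 r) (σ q) ^ (j : ℕ)) ((j : ℕ) : ℚ_[p]) =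
      MonoidAlgebra.mapRingHom (ZMod (cycLevel p 0 r))ˣ (PadicInt.Coe.ringHom (p := p))
          (Θ₀ * (P * V) * ∏ q ∈ r, ∑ j : Fin (((primesEquiv q : Nat.Primes) : ℕ) - 1),
            MonoidAlgebra.single (modNCyclotomicCharacter ℚ (cycLevel p 0 r) (σ q) ^ (j : ℕ))
              ((j : ℕ) : ℤ_[p])) +
        ((p : ℚ_[p]) ^ (k + 1)) •
          MonoidAlgebra.mapRingHom (ZMod (cycLevel p 0 r))ˣ (PadicInt.Coe.ringHom (p := p)) (P * Wc) := by
    rw [map_mul _ (Θ₀ * (P * V)), hDint, ← hpW, ← hY]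
    ring
  -- ### the seat's twisted glue ★★ (hval on the twisted lattice) + the unit reading of the scalar
  haveI : NeZero (p ^ (k + 1)) := ⟨pow_ne_zero _ (Fact.out : p.Prime).ne_zero⟩
  set c : ZMod (p ^ (k + 1)) := (-1 : ZMod (p ^ (k + 1))) ^ (cycLevel p 0 r).primeFactors.card *
    kuriharaNumber f (p ^ (k + 1)) (cycLevel p 0 r) ψ with hcdef
  obtain ⟨l, hl, hval⟩ :=
    KimAtThreeShallowEqDeepAnomalousGlue.exists_mem_cycIntLattice_symm_deriv_sub_tmul_eq_pow_smul_twist_of_comparison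
      p (cycLevel p 0 r) r (fun q => modNCyclotomicCharacter ℚ (cycLevel p 0 r) (σ q))
      (fun q => ((primesEquiv q : Nat.Primes) : ℕ) - 1) xr X hxX _ u hu Θ₀ P V Wc (k + 1) c hXY hPK3 hnorm
      ((c.val : ℕ) : ℤ_[p]) (by rw [map_natCast, ZMod.natCast_zmod_val])
      (ZetaValue.pairwise_commute_fieldDeriv (cycLevel p 0 r)
        (fun ℓ => modNCyclotomicCharacter ℚ (cycLevel p 0 r) (σ ℓ))
        (fun ℓ => ((primesEquiv ℓ : Nat.Primes) : ℕ) - 1) r)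
  -- ### packaging in PK-6₂'s currency (`ψ` onto at `N𝔮`; `kuriharaNumber` at `∏ N𝔮`)
  refine ⟨(↑u⁻¹ : ℤ_[p]) * ((c.val : ℕ) : ℤ_[p]) *
      ((ArithmeticFunction.moebius (cycLevel p 0 r) : ℤ) : ℤ_[p]) * (∑ g : (ZMod (cycLevel p 0 r))ˣ, V.coeff g),
    (Units.map (PadicInt.toZModPow (p := p) (k + 1)).toMonoidHom u)⁻¹ * hV'.unit, ψ,
    fun q hq => (hψ _ q hq rfl).1, ⟨l, hl, hval⟩, ?_⟩
  haveI : NeZero (∏ q ∈ r, Ideal.absNorm q.asIdeal) :=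
    ⟨Finset.prod_ne_zero_iff.2 fun q _ h => q.ne_bot (Ideal.absNorm_eq_zero_iff.1 h)⟩
  rw [← kuriharaNumber_congr f (p ^ (k + 1)) (cycLevel_zero_eq_prod_absNorm p r) ψ, pow_zero, mul_one]
  have hinv : (((Units.map (PadicInt.toZModPow (p := p) (k + 1)).toMonoidHom u)⁻¹ :
      (ZMod (p ^ (k + 1)))ˣ) : ZMod (p ^ (k + 1))) = PadicInt.toZModPow (k + 1) (↑u⁻¹ : ℤ_[p]) := by
    rw [Units.coe_map_inv]
    rfl
  rw [Units.val_mul, hinv, IsUnit.unit_spec, map_mul, map_mul, map_mul, map_natCast, map_intCast,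
    ZMod.natCast_zmod_val, hcdef]
  have h1 := GroupRingEval.neg_one_pow_card_primeFactors_mul_moebius (cycLevel p 0 r)
    (S := ZMod (p ^ (k + 1))) hsf
  linear_combination (PadicInt.toZModPow (k + 1) (↑u⁻¹ : ℤ_[p]) *
    kuriharaNumber f (p ^ (k + 1)) (cycLevel p 0 r) ψ *
      PadicInt.toZModPow (k + 1) (∑ g : (ZMod (cycLevel p 0 r))ˣ, V.coeff g)) * h1

end Summit.BirchSwinnertonDyer.BirchSwinnertonDyer.Theorems.KimAtThreeShallowEqDeepAnomalousValueRow

end
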